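import Summits.CriticalPhenomena.PercolationContinuityZ3.Theorems.PercNearOneGluingNoHeavyLowerTailQuantitativeBHKRepulsion
import Summits.CriticalPhenomena.PercolationContinuityZ3.Theorems.PercNearOneGluingNoHeavyLowerTailQuantitativeBHKSeparation
import Literature.Probability.LatticeModels.ProdBernoulliAtomExpansion
import HarnessLib

/-!
# The attachment floor for the two-cluster repulsion (quantitative BHK Thm 1.4 / eq. (2), «(att)» member)

Support file (`--supports stmt-CriticalPhenomena-4575`), prover seat `prim-rate-mine-2` (lane prim-rate, constants-miner (c), BENCH row
M2-R11 (att); `run/shared/lean/prim/prim-rate/prim-rate-mine-2/CANDIDATES.md` §gen-2, PROOFS.md §P8–P10).  No definitions, no named facts,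
no sorries; standard axioms.  van den Berg–Häggström–Kahn (2006) prove that given `{s ↮ t}` the clusters `C_s`, `C_t` are NEGATIVELY
correlated (Thm 1.4, eq. (2)) — a sign statement; the kernel holds the abstract quantitative form `QuantBHK.twoCluster_negCov_ge_majorant_gap`
and its weakest connection instance, the deletion member `twoCluster_repulsion_openConn_ge_deletion`.  Here the row's ATTACHMENT member lands
AS TYPED: for weights supported on a pair set `E`, `D = {s ↮ t}`, vertices `a, o` and `P_W(t↔o)` = the probability that `t ↔ o` off the pairs
meeting `W`,  `μ(D ∩ {s↔a})·∫_D (P_{C_s}(t↔o) − M) dμ ≤ μ(D ∩ {s↔a})μ(D ∩ {t↔o}) − μ(D)μ(D ∩ {s↔a} ∩ {t↔o})` for EVERY `M` dominating the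
attachment values `P_{C_s ∪ U}(t↔o)` (`U` a vertex set through which `a` is joined to `C_s` by pairs of `E`) — `twoCluster_repulsion_openConn_ge_attachment` —
and the explicit instance `M = max_U` (`…_attachmentSup`): `−Cov(1{s↔a},1{t↔o} | s↮t) ≥ ν(s↔a)·E_ν[1{s↮a}(P_{C_s}(t↔o) − max_γ P_{C_s∪γ}(t↔o))]`,
the max attained on paths `γ` of `E` from `C_s` to `a`; the deletion member is `M = P_{C_s ∪ {a}}` (`…_deletion'`).  Proof: the abstract floor
with the lifted cluster `R(W) = openCluster (W ∩ E) s`, `F = 1{a ∈ R}`, and the min-hull majorant `G̃(W) = min_U {−P_{{s}∪V(W)∪U}(t↔o) : a attached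
to R(W) through U}`, increasing on ALL edge sets by attachment transfer; a.s. `R(C_s^edge) = C_s`.
[cite: VandenbergHaggstromKahn2005, Thm. 1.4 and eq. (2) (pp. 2, 7), display (10) (p. 7)]
-/


noncomputable section

namespace Summit.CriticalPhenomena.PercolationContinuityZ3.Theorems

open MeasureTheory Set Literature.Probability.LatticeModels Literature.Probability.Percolation
open scoped Classical
open Literature.Probability.Percolation.BHK2006 DecisionTree

namespace QuantBHK

universe v

variable {V : Type v} [Fintype V]

omit [Fintype V] in
/-- Walk transfer: a vertex reachable from `s` in `W ∩ E` is reachable by pairs of `E` both of whose endpoints lie in the lifted cluster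
`openCluster (W ∩ E) s` (or in any extra set `U`). [folklore] -/
theorem reachable_inside_liftedCluster {E W : Set (Sym2 V)} {s a : V} (U : Set V)
    (h : (openGraph (W ∩ E)).Reachable s a) :
    (openGraph {e | e ∈ E ∧ ∀ v ∈ e, v ∈ openCluster (W ∩ E) s ∨ v ∈ U}).Reachable s a := by
  obtain ⟨p⟩ := h
  refine ⟨p.transfer (openGraph {e | e ∈ E ∧ ∀ v ∈ e, v ∈ openCluster (W ∩ E) s ∨ v ∈ U}) fun e he => ?_⟩
  have he' := p.edges_subset_edgeSet he
  rw [openGraph, SimpleGraph.edgeSet_fromEdgeSet] at he'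
  rw [openGraph, SimpleGraph.edgeSet_fromEdgeSet]
  refine ⟨⟨he'.1.2, fun v hv => Or.inl ?_⟩, he'.2⟩
  exact (p.takeUntil v (SimpleGraph.Walk.mem_support_of_mem_edges he hv)).reachable

omit [Fintype V] in
/-- The lifted cluster `openCluster (W ∩ E) s` lies in the vertex span `{s} ∪ V(W)`. [folklore] -/
theorem liftedCluster_subset_span (E W : Set (Sym2 V)) (s : V) :
    openCluster (W ∩ E) s ⊆ {v | v = s ∨ ∃ e' ∈ W, v ∈ e'} := by
  intro v hv
  rw [KNPreFKG.openCluster_eq_setOf_openEdgeCluster] at hv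
  rcases hv with h | ⟨e, he, hve⟩
  · exact Or.inl h
  · exact Or.inr ⟨e, (openEdgeCluster_subset _ s he).1, hve⟩

omit [Fintype V] in
/-- If `a` is reachable from `s` by pairs both of whose endpoints lie in `C ∪ U`, then `a = s` or `a ∈ C ∪ U` (look at the last pair). [folklore] -/
theorem mem_or_mem_of_reachable_inside {S : Set (Sym2 V)} {C U : Set V} {s a : V}
    (h : (openGraph {e | e ∈ S ∧ ∀ v ∈ e, v ∈ C ∨ v ∈ U}).Reachable s a) : a = s ∨ a ∈ C ∨ a ∈ U := by
  obtain ⟨p⟩ := h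
  cases hp : p.reverse with
  | nil => exact Or.inl rfl
  | cons hadj _ =>
    have he := hadj
    rw [openGraph, SimpleGraph.fromEdgeSet_adj] at he
    exact Or.inr (he.1.2 a (Sym2.mem_mk_left _ _))

/-- **Attachment floor for the two-cluster repulsion (quantitative BHK Thm 1.4 / eq. (2)), dominator form.**  Weights supported on the pair
set `E` (`w e = 0` off `E`), `D = {s ↮ t}`, `s ≠ t`, vertices `a, o`, `C_s = openCluster ω s`, and `P_W(t↔o) := μ{η : t ↔ o in η ∖ W̄}`
(`W̄` = the pairs meeting the vertex set `W`).  Let `M : BondConfig V → ℝ` dominate every ATTACHMENT VALUE: whenever `a` is joined to `s` by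
pairs of `E` with both endpoints in `C_s(ω) ∪ U` (`U : Set V` an «attachment set»), `P_{C_s(ω) ∪ U}(t↔o) ≤ M ω`.  Then
  `μ(D ∩ {s↔a}) · ∫_D ( P_{C_s}(t↔o) − M ) dμ ≤ μ(D ∩ {s↔a})·μ(D ∩ {t↔o}) − μ(D)·μ(D ∩ {s↔a} ∩ {t↔o})`,
i.e. `−Cov(1{s↔a}, 1{t↔o} | s↮t) ≥ ν(s↔a)·E_ν[P_{C_s}(t↔o) − M]`.  With `M =` the maximum attachment value this is BENCH row M2-R11 (att)
of the prim-rate lane (`twoCluster_repulsion_openConn_ge_attachmentSup`); with `M = P_{C_s ∪ {a}}` it is the deletion member.  Proof: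
`twoCluster_negCov_ge_majorant_gap` with `F = 1{a ∈ R(W)}`, `R(W) = openCluster (W ∩ E) s`, and the min-hull majorant
`G̃(W) = ⨅_U [a attached to R(W) through U] (−P_{{s} ∪ V(W) ∪ U}(t↔o))`, increasing on all edge sets.
[cite: VandenbergHaggstromKahn2005, Thm. 1.4 and eq. (2) (pp. 2, 7)] -/
theorem twoCluster_repulsion_openConn_ge_attachment (w : Sym2 V → unitInterval) (E : Set (Sym2 V))
    (hE : ∀ e, e ∉ E → (w e : ℝ) = 0) (s t a o : V) (hst : s ≠ t) (M : BondConfig V → ℝ)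
    (hM : ∀ (ω : BondConfig V) (U : Set V),
      (openGraph {e | e ∈ E ∧ ∀ v ∈ e, v ∈ openCluster ω s ∨ v ∈ U}).Reachable s a →
        (prodBernoulli w).real {η : BondConfig V |
          (openGraph (η \ {e | ∃ v ∈ e, v ∈ openCluster ω s ∨ v ∈ U})).Reachable t o} ≤ M ω) :
    (prodBernoulli w).real ({ω : BondConfig V | ¬ (openGraph ω).Reachable s t} ∩ openConn s a) *
      (∫ ω in {ω : BondConfig V | ¬ (openGraph ω).Reachable s t},
        ((prodBernoulli w).real {η : BondConfig V |
            (openGraph (η \ {e | ∃ v ∈ e, v ∈ openCluster ω s})).Reachable t o} - M ω) ∂(prodBernoulli w)) ≤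
    (prodBernoulli w).real ({ω : BondConfig V | ¬ (openGraph ω).Reachable s t} ∩ openConn s a) *
        (prodBernoulli w).real ({ω : BondConfig V | ¬ (openGraph ω).Reachable s t} ∩ openConn t o) -
      (prodBernoulli w).real {ω : BondConfig V | ¬ (openGraph ω).Reachable s t} *
        (prodBernoulli w).real ({ω : BondConfig V | ¬ (openGraph ω).Reachable s t} ∩ openConn s a ∩ openConn t o) := by
  set μ := prodBernoulli w with hμ
  set w' : Sym2 V → ℝ := fun e => (w e : ℝ) with hw'
  set D : Set (BondConfig V) := {ω : BondConfig V | ¬ (openGraph ω).Reachable s t} with hD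
  have hmeas : ∀ S : Set (BondConfig V), MeasurableSet S := fun _ => MeasurableSet.of_discrete
  have hspan : ∀ (ζ : BondConfig V) (x y : V), (y = x ∨ ∃ e' ∈ openEdgeCluster ζ x, y ∈ e') ↔ y ∈ openCluster ζ x := by
    intro ζ x y; rw [KNPreFKG.openCluster_eq_setOf_openEdgeCluster]; rfl
  have hnull : μ {ω : BondConfig V | ∃ e ∈ (Eᶜ : Set (Sym2 V)).toFinset, e ∈ ω} = 0 :=
    prodBernoulli_setOf_exists_mem_eq_zero w _ fun e he => hE e (by simpa using he)
  have haeE : ∀ᵐ ω ∂μ, ω ⊆ E := by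
    have h1 : ∀ᵐ ω ∂μ, ω ∉ {ω : BondConfig V | ∃ e ∈ (Eᶜ : Set (Sym2 V)).toFinset, e ∈ ω} :=
      measure_eq_zero_iff_ae_notMem.1 hnull
    filter_upwards [h1] with ω hω
    intro e he
    by_contra heE
    exact hω ⟨e, by simpa using heE, he⟩
  -- trivial case: `a` not reachable from `s` inside `E`
  by_cases hEa : (openGraph E).Reachable s a
  swap
  · have h0 : μ.real (D ∩ openConn s a) = 0 := by
      have hsub : D ∩ openConn s a ⊆ {ω : BondConfig V | ∃ e ∈ (Eᶜ : Set (Sym2 V)).toFinset, e ∈ ω} := by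
        rintro ω ⟨_, hω⟩
        by_contra hω'
        have hωE : ω ⊆ E := by
          intro e he
          by_contra heE
          exact hω' ⟨e, by simpa using heE, he⟩
        exact hEa ((show (openGraph ω).Reachable s a from hω).mono (openGraph_le hωE))
      exact measureReal_mono_null hsub ((measureReal_eq_zero_iff (measure_ne_top _ _)).2 hnull)
    rw [h0, measureReal_mono_null Set.inter_subset_left h0]
    simp
  -- `M` is nonnegative (attachment through `U = univ`)
  have hM0 : ∀ ω, 0 ≤ M ω := by
    intro ω
    have hreach : (openGraph {e | e ∈ E ∧ ∀ v ∈ e, v ∈ openCluster ω s ∨ v ∈ (Set.univ : Set V)}).Reachable s a := by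
      refine hEa.mono (openGraph_le fun e he => ⟨he, fun v _ => Or.inr (Set.mem_univ v)⟩)
    exact le_trans measureReal_nonneg (hM ω Set.univ hreach)
  -- the lifted cluster, the attachment predicate, the deleted pair sets and the residual probability
  set R : Set (Sym2 V) → Set V := fun W => openCluster (W ∩ E) s with hR
  set adm : Set (Sym2 V) → Set V → Prop := fun W U =>
    (openGraph {e | e ∈ E ∧ ∀ v ∈ e, v ∈ R W ∨ v ∈ U}).Reachable s a with hadm
  set B : Set (Sym2 V) → Set (Sym2 V) := fun W => {e | ∃ v ∈ e, v = s ∨ ∃ e' ∈ W, v ∈ e'} with hB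
  set Bu : Set V → Set (Sym2 V) → Set (Sym2 V) := fun U W => {e : Sym2 V | ∃ v ∈ e, (v = s ∨ ∃ e' ∈ W, v ∈ e') ∨ v ∈ U} with hBu
  set P : Set (Sym2 V) → ℝ := fun Bset => μ.real {η : BondConfig V | (openGraph (η \ Bset)).Reachable t o} with hP
  have hPanti : ∀ B1 B2 : Set (Sym2 V), B1 ⊆ B2 → P B2 ≤ P B1 := by
    intro B1 B2 h
    exact measureReal_mono fun η hη =>
      (show (openGraph (η \ B2)).Reachable t o from hη).mono (openGraph_le (sdiff_le_sdiff_left h))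
  have hP0 : ∀ Bset, 0 ≤ P Bset := fun _ => measureReal_nonneg
  have hRmono : ∀ W W' : Set (Sym2 V), W ⊆ W' → R W ⊆ R W' := fun W W' h =>
    openCluster_mono (Set.inter_subset_inter_left E h) s
  have hRspan : ∀ W : Set (Sym2 V), R W ⊆ {v | v = s ∨ ∃ e' ∈ W, v ∈ e'} := fun W =>
    liftedCluster_subset_span E W s
  -- attachment transfer
  have hadm_mono : ∀ (W W' : Set (Sym2 V)) (U U' : Set V), W ⊆ W' → U ⊆ U' → adm W U → adm W' U' := by
    intro W W' U U' hW hU h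
    refine h.mono (openGraph_le fun e he => ⟨he.1, fun v hv => ?_⟩)
    rcases he.2 v hv with h1 | h1
    · exact Or.inl (hRmono W W' hW h1)
    · exact Or.inr (hU h1)
  have hadm_transfer : ∀ (W W' : Set (Sym2 V)) (U : Set V), adm W' U → adm W (U ∪ R W') := by
    intro W W' U h
    refine h.mono (openGraph_le fun e he => ⟨he.1, fun v hv => ?_⟩)
    rcases he.2 v hv with h1 | h1
    · exact Or.inr (Or.inr h1)
    · exact Or.inr (Or.inl h1)
  have hadm_of_mem : ∀ (W : Set (Sym2 V)) (U : Set V), a ∈ R W → adm W U := fun W U ha =>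
    reachable_inside_liftedCluster U ha
  have hBu_mono : ∀ (U U' : Set V) (W W' : Set (Sym2 V)), U ⊆ U' → W ⊆ W' → Bu U W ⊆ Bu U' W' := by
    intro U U' W W' hU hW e he
    obtain ⟨v, hv, h⟩ := he
    refine ⟨v, hv, ?_⟩
    rcases h with (h | ⟨e', he', hve'⟩) | h
    · exact Or.inl (Or.inl h)
    · exact Or.inl (Or.inr ⟨e', hW he', hve'⟩)
    · exact Or.inr (hU h)
  have hBu_transfer : ∀ (U : Set V) (W W' : Set (Sym2 V)), W ⊆ W' → Bu (U ∪ R W') W ⊆ Bu U W' := by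
    intro U W W' hW e he
    obtain ⟨v, hv, h⟩ := he
    refine ⟨v, hv, ?_⟩
    rcases h with (h | ⟨e', he', hve'⟩) | (h | h)
    · exact Or.inl (Or.inl h)
    · exact Or.inl (Or.inr ⟨e', hW he', hve'⟩)
    · exact Or.inr h
    · exact Or.inl (hRspan W' h)
  have hBu_empty : ∀ W : Set (Sym2 V), Bu ∅ W = B W := by
    intro W; ext e
    simp only [hBu, hB, Set.mem_setOf_eq, Set.mem_empty_iff_false, or_false]
  have hB_sub_Bu : ∀ (U : Set V) (W : Set (Sym2 V)), B W ⊆ Bu U W := by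
    intro U W
    rw [← hBu_empty W]
    exact hBu_mono ∅ U W W (Set.empty_subset U) le_rfl
  -- the min-hull majorant
  set f : Set (Sym2 V) → Set V → ℝ := fun W U => if adm W U then -P (Bu U W) else 0 with hf
  have hf_le0 : ∀ W U, f W U ≤ 0 := by
    intro W U
    simp only [hf]
    split_ifs <;> [exact neg_nonpos.2 (hP0 _); exact le_rfl]
  have hf_bdd : ∀ W, BddBelow (Set.range (f W)) := fun W => (Set.finite_range (f W)).bddBelow
  set Gt : Set (Sym2 V) → ℝ := fun W => ⨅ U : Set V, f W U with hGt
  have hGt_le : ∀ W U, Gt W ≤ f W U := fun W U => ciInf_le (hf_bdd W) U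
  have hGtmono : Monotone Gt := by
    intro W W' hWW'
    refine le_ciInf fun U => ?_
    by_cases hU : adm W' U
    · have h1 : Gt W ≤ f W (U ∪ R W') := hGt_le W _
      have h2 : f W (U ∪ R W') = -P (Bu (U ∪ R W') W) := by
        simp only [hf, if_pos (hadm_transfer W W' U hU)]
      rw [show f W' U = -P (Bu U W') by simp only [hf, if_pos hU]]
      exact (h2 ▸ h1).trans (neg_le_neg (hPanti _ _ (hBu_transfer U W W' hWW')))
    · rw [show f W' U = 0 by simp only [hf, if_neg hU]]
      exact (hGt_le W U).trans (hf_le0 W U)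
  have hGt_eq : ∀ W, a ∈ R W → Gt W = -P (B W) := by
    intro W ha
    refine le_antisymm ?_ (le_ciInf fun U => ?_)
    · have h2 : f W ∅ = -P (B W) := by simp only [hf, if_pos (hadm_of_mem W ∅ ha), hBu_empty W]
      exact h2 ▸ hGt_le W ∅
    · simp only [hf]
      split_ifs
      · exact neg_le_neg (hPanti _ _ (hB_sub_Bu U W))
      · exact neg_nonpos.2 (hP0 _)
  -- the functionals of the abstract theorem
  set F : Set (Sym2 V) → ℝ := fun W => if a ∈ R W then 1 else 0 with hF
  set g : Set (Sym2 V) → ℝ := fun K => if (o = t ∨ ∃ e' ∈ K, o ∈ e') then 1 else 0 with hg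
  set Ψ : Set (Sym2 V) → ℝ := fun W => ∑ η, weight w' η * g (openEdgeCluster (η \ B W) t) with hΨ
  have hFmono : Monotone F := by
    intro W W' h
    simp only [hF]
    by_cases ha : a ∈ R W
    · rw [if_pos ha, if_pos (hRmono W W' h ha)]
    · rw [if_neg ha]; split_ifs <;> norm_num
  have hgmono : Monotone g := by
    intro K K' h
    by_cases hy : (o = t ∨ ∃ e' ∈ K, o ∈ e')
    · have hy' : (o = t ∨ ∃ e' ∈ K', o ∈ e') := hy.imp id fun ⟨e', he', hye'⟩ => ⟨e', h he', hye'⟩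
      simp only [hg, if_pos hy, if_pos hy', le_refl]
    · simp only [hg, if_neg hy]; split_ifs <;> norm_num
  -- the residual connection probabilities as sums
  have hres : ∀ (Bset : Set (Sym2 V)),
      ∑ η, weight w' η * g (openEdgeCluster (η \ Bset) t) = P Bset := by
    intro Bset
    simp only [hP]
    rw [← integral_indicator_one (hmeas _), integral_prodBernoulli_eq_sum]
    refine Finset.sum_congr rfl fun η _ => ?_
    congr 1
    simp only [hg, hspan (η \ Bset) t o, Set.indicator_apply, Set.mem_setOf_eq, Pi.one_apply]
    rfl
  have hΨP : ∀ W, Ψ W = P (B W) := fun W => hres (B W)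
  have hFG : ∀ W, F W * Gt W = F W * -Ψ W := by
    intro W
    by_cases ha : a ∈ R W
    · rw [hGt_eq W ha, hΨP W]
    · simp only [hF, if_neg ha, zero_mul]
  have key := twoCluster_negCov_ge_majorant_gap w s t hst F g Gt hFmono hGtmono hFG
  rw [← hμ, ← hD] at key
  -- a.s. identification of the lifted cluster with the cluster
  have hae : ∀ᵐ ω ∂μ, R (openEdgeCluster ω s) = openCluster ω s := by
    filter_upwards [haeE] with ω hωE
    have hCE : openEdgeCluster ω s ∩ E = openEdgeCluster ω s :=
      Set.inter_eq_left.2 ((openEdgeCluster_subset ω s).trans hωE)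
    simp only [hR, hCE, openCluster_openEdgeCluster]
  have hint : ∀ (f : BondConfig V → ℝ) (A : Set (BondConfig V)),
      (∀ ω, R (openEdgeCluster ω s) = openCluster ω s → f ω = if ω ∈ A then (1 : ℝ) else 0) →
      ∫ ω in D, f ω ∂μ = μ.real (D ∩ A) := by
    intro f A hA
    have h1 : ∫ ω in D, f ω ∂μ = ∫ ω in D, A.indicator (fun _ => (1 : ℝ)) ω ∂μ := by
      refine setIntegral_congr_ae (hmeas D) ?_
      filter_upwards [hae] with ω hω _
      rw [hA ω hω, Set.indicator_apply]
    rw [h1, integral_indicator (hmeas A), Measure.restrict_restrict (hmeas A), integral_const, smul_eq_mul, mul_one,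
      Set.inter_comm, measureReal_restrict_apply_univ]
  have hIF : ∫ ω in D, F (openEdgeCluster ω s) ∂μ = μ.real (D ∩ openConn s a) :=
    hint (fun ω => F (openEdgeCluster ω s)) (openConn s a) fun ω hω => by
      simp only [hF, hω]
      exact if_congr Iff.rfl rfl rfl
  have hIg : ∫ ω in D, g (openEdgeCluster ω t) ∂μ = μ.real (D ∩ openConn t o) :=
    hint (fun ω => g (openEdgeCluster ω t)) (openConn t o) fun ω _ => by
      simp only [hg, hspan ω t o]
      exact if_congr Iff.rfl rfl rfl
  have hIFg : ∫ ω in D, F (openEdgeCluster ω s) * g (openEdgeCluster ω t) ∂μ =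
      μ.real (D ∩ openConn s a ∩ openConn t o) := by
    rw [Set.inter_assoc]
    refine hint (fun ω => F (openEdgeCluster ω s) * g (openEdgeCluster ω t)) (openConn s a ∩ openConn t o)
      fun ω hω => ?_
    simp only [hF, hg, hω, hspan ω t o]
    by_cases h1 : a ∈ openCluster ω s
    · by_cases h2 : o ∈ openCluster ω t
      · rw [if_pos h1, if_pos h2, one_mul, if_pos (show ω ∈ openConn s a ∩ openConn t o from ⟨h1, h2⟩)]
      · rw [if_pos h1, if_neg h2, one_mul, if_neg (show ω ∉ openConn s a ∩ openConn t o from fun h => h2 h.2)]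
    · rw [if_neg h1, zero_mul, if_neg (show ω ∉ openConn s a ∩ openConn t o from fun h => h1 h.1)]
  -- display (10): `∫_D g(C_t) = ∫_D Ψ(C_s) = ∫_D P_{C_s}(t↔o)`
  have hBC : ∀ ω : BondConfig V, B (openEdgeCluster ω s) = {e | ∃ v ∈ e, v ∈ openCluster ω s} := by
    intro ω; ext e
    simp only [hB, Set.mem_setOf_eq, hspan ω s]
  have h10 : ∫ ω in D, g (openEdgeCluster ω t) ∂μ =
      ∫ ω in D, μ.real {η : BondConfig V | (openGraph (η \ {e | ∃ v ∈ e, v ∈ openCluster ω s})).Reachable t o} ∂μ := by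
    have hm : ∑ ω, weight w' ω = 1 := by
      have h1 := integral_prodBernoulli_eq_sum w fun _ => (1 : ℝ)
      simp only [integral_const, probReal_univ, smul_eq_mul, mul_one] at h1
      exact h1.symm
    have h10a : ∫ ω in D, g (openEdgeCluster ω t) ∂μ = ∫ ω in D, Ψ (openEdgeCluster ω s) ∂μ := by
      rw [setIntegral_eq_sum_weight, setIntegral_eq_sum_weight]
      exact sum_cond_cluster w' hm s t (fun _ K => g K) fun ω => Iff.rfl
    rw [h10a]
    refine setIntegral_congr_fun (hmeas D) fun ω _ => ?_
    simp only [hΨP, hP, hBC ω]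
  -- the pointwise floor `Gt(C_s) ≥ -M`
  have hBuC : ∀ (ω : BondConfig V) (U : Set V),
      Bu U (openEdgeCluster ω s) = {e | ∃ v ∈ e, v ∈ openCluster ω s ∨ v ∈ U} := by
    intro ω U; ext e
    simp only [hBu, Set.mem_setOf_eq, hspan ω s]
  have hGtM : ∀ᵐ ω ∂μ, -M ω ≤ Gt (openEdgeCluster ω s) := by
    filter_upwards [hae] with ω hω
    refine le_ciInf fun U => ?_
    by_cases hU : adm (openEdgeCluster ω s) U
    · rw [show f (openEdgeCluster ω s) U = -P (Bu U (openEdgeCluster ω s)) by simp only [hf, if_pos hU], hBuC ω U]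
      have hU' : (openGraph {e | e ∈ E ∧ ∀ v ∈ e, v ∈ openCluster ω s ∨ v ∈ U}).Reachable s a := by
        have h2 := hU
        simp only [hadm, hω] at h2
        exact h2
      exact neg_le_neg (hM ω U hU')
    · rw [show f (openEdgeCluster ω s) U = 0 by simp only [hf, if_neg hU]]
      exact neg_nonpos.2 (hM0 ω)
  have hIGt : ∫ ω in D, -M ω ∂μ ≤ ∫ ω in D, Gt (openEdgeCluster ω s) ∂μ := by
    refine integral_mono_ae (Integrable.of_finite) (Integrable.of_finite) ?_
    exact ae_restrict_of_ae hGtM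
  have hfloor : ∫ ω in D, (μ.real {η : BondConfig V |
        (openGraph (η \ {e | ∃ v ∈ e, v ∈ openCluster ω s})).Reachable t o} - M ω) ∂μ ≤
      (∫ ω in D, Gt (openEdgeCluster ω s) ∂μ) + ∫ ω in D, g (openEdgeCluster ω t) ∂μ := by
    rw [integral_sub (Integrable.of_finite) (Integrable.of_finite), h10]
    rw [integral_neg] at hIGt
    linarith
  rw [hIF, hIg, hIFg] at key
  have hnn : 0 ≤ μ.real (D ∩ openConn s a) := measureReal_nonneg
  calc μ.real (D ∩ openConn s a) * ∫ ω in D, (μ.real {η : BondConfig V |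
          (openGraph (η \ {e | ∃ v ∈ e, v ∈ openCluster ω s})).Reachable t o} - M ω) ∂μ
      ≤ μ.real (D ∩ openConn s a) *
          ((∫ ω in D, Gt (openEdgeCluster ω s) ∂μ) + ∫ ω in D, g (openEdgeCluster ω t) ∂μ) :=
        mul_le_mul_of_nonneg_left hfloor hnn
    _ ≤ _ := by rw [hIg]; exact key

/-- **Attachment floor, explicit form (BENCH row M2-R11 (att) AS TYPED).**  Weights supported on `E`, `D = {s ↮ t}`, `s ≠ t`, vertices `a, o`:
  `μ(D ∩ {s↔a}) · ∫_D ( P_{C_s}(t↔o) − max_U P_{C_s ∪ U}(t↔o) ) dμ ≤ μ(D ∩ {s↔a})·μ(D ∩ {t↔o}) − μ(D)·μ(D ∩ {s↔a} ∩ {t↔o})`,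
the maximum (written `⨆` over vertex sets `U`, value `0` for non-attaching `U`) running over the ATTACHMENT SETS `U` through which `a` is joined to
`s` by pairs of `E` with endpoints in `C_s ∪ U`; since `P_{C_s ∪ U}` is antitone in `U` the maximum is attained on the vertex sets of paths `γ` of
`E` from `C_s` to `a`, so this is `−Cov_ν(1{s↔a}, 1{t↔o}) ≥ ν(s↔a)·E_ν[1{s↮a}·(P_{Γ∖C_s}(t↔o) − max_γ P_{Γ∖(C_s∪γ)}(t↔o))]` for `Γ = E`
(«given s ↮ a, the cheapest way of attaching a to C_s blocks t ↔ o with at least this probability»; the integrand vanishes on `{s ↔ a}`).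
[cite: VandenbergHaggstromKahn2005, Thm. 1.4 and eq. (2) (pp. 2, 7)] -/
theorem twoCluster_repulsion_openConn_ge_attachmentSup (w : Sym2 V → unitInterval) (E : Set (Sym2 V))
    (hE : ∀ e, e ∉ E → (w e : ℝ) = 0) (s t a o : V) (hst : s ≠ t) :
    (prodBernoulli w).real ({ω : BondConfig V | ¬ (openGraph ω).Reachable s t} ∩ openConn s a) *
      (∫ ω in {ω : BondConfig V | ¬ (openGraph ω).Reachable s t},
        ((prodBernoulli w).real {η : BondConfig V |
            (openGraph (η \ {e | ∃ v ∈ e, v ∈ openCluster ω s})).Reachable t o} -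
          ⨆ U : Set V, (if (openGraph {e | e ∈ E ∧ ∀ v ∈ e, v ∈ openCluster ω s ∨ v ∈ U}).Reachable s a then
            (prodBernoulli w).real {η : BondConfig V |
              (openGraph (η \ {e | ∃ v ∈ e, v ∈ openCluster ω s ∨ v ∈ U})).Reachable t o} else 0)) ∂(prodBernoulli w)) ≤
    (prodBernoulli w).real ({ω : BondConfig V | ¬ (openGraph ω).Reachable s t} ∩ openConn s a) *
        (prodBernoulli w).real ({ω : BondConfig V | ¬ (openGraph ω).Reachable s t} ∩ openConn t o) -
      (prodBernoulli w).real {ω : BondConfig V | ¬ (openGraph ω).Reachable s t} *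
        (prodBernoulli w).real ({ω : BondConfig V | ¬ (openGraph ω).Reachable s t} ∩ openConn s a ∩ openConn t o) := by
  refine twoCluster_repulsion_openConn_ge_attachment w E hE s t a o hst _ fun ω U hU => ?_
  have h := le_ciSup (Set.finite_range fun U' : Set V =>
    if (openGraph {e | e ∈ E ∧ ∀ v ∈ e, v ∈ openCluster ω s ∨ v ∈ U'}).Reachable s a then (prodBernoulli w).real
      {η : BondConfig V | (openGraph (η \ {e | ∃ v ∈ e, v ∈ openCluster ω s ∨ v ∈ U'})).Reachable t o} else 0).bddAbove U
  simp only [if_pos hU] at h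
  exact h

/-- **The deletion member recovered** (consistency with `twoCluster_repulsion_openConn_ge_deletion`, here for weights supported on `E`):
`M = P_{C_s ∪ {a}}(t↔o)` dominates every attachment value, because an attachment set through which `a` is reached contains `a`
(or `a ∈ C_s`). [cite: VandenbergHaggstromKahn2005, Thm. 1.4 and eq. (2) (pp. 2, 7)] -/
theorem twoCluster_repulsion_openConn_ge_deletion' (w : Sym2 V → unitInterval) (E : Set (Sym2 V))
    (hE : ∀ e, e ∉ E → (w e : ℝ) = 0) (s t a o : V) (hst : s ≠ t) :
    (prodBernoulli w).real ({ω : BondConfig V | ¬ (openGraph ω).Reachable s t} ∩ openConn s a) *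
      (∫ ω in {ω : BondConfig V | ¬ (openGraph ω).Reachable s t},
        ((prodBernoulli w).real {η : BondConfig V |
            (openGraph (η \ {e | ∃ v ∈ e, v ∈ openCluster ω s})).Reachable t o} -
          (prodBernoulli w).real {η : BondConfig V |
            (openGraph (η \ {e | ∃ v ∈ e, v ∈ openCluster ω s ∨ v = a})).Reachable t o}) ∂(prodBernoulli w)) ≤
    (prodBernoulli w).real ({ω : BondConfig V | ¬ (openGraph ω).Reachable s t} ∩ openConn s a) *
        (prodBernoulli w).real ({ω : BondConfig V | ¬ (openGraph ω).Reachable s t} ∩ openConn t o) -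
      (prodBernoulli w).real {ω : BondConfig V | ¬ (openGraph ω).Reachable s t} *
        (prodBernoulli w).real ({ω : BondConfig V | ¬ (openGraph ω).Reachable s t} ∩ openConn s a ∩ openConn t o) := by
  refine twoCluster_repulsion_openConn_ge_attachment w E hE s t a o hst _ fun ω U hU => ?_
  have hsub : ({e | ∃ v ∈ e, v ∈ openCluster ω s ∨ v = a} : Set (Sym2 V)) ⊆
      {e | ∃ v ∈ e, v ∈ openCluster ω s ∨ v ∈ U} := by
    intro e he
    obtain ⟨v, hv, h⟩ := he
    rcases h with h | h
    · exact ⟨v, hv, Or.inl h⟩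
    · subst h
      rcases mem_or_mem_of_reachable_inside hU with h1 | h1 | h1
      · exact ⟨v, hv, Or.inl (h1 ▸ mem_openCluster_self ω s)⟩
      · exact ⟨v, hv, Or.inl h1⟩
      · exact ⟨v, hv, Or.inr h1⟩
  refine measureReal_mono (fun η hη => ?_)
  exact (show (openGraph (η \ {e | ∃ v ∈ e, v ∈ openCluster ω s ∨ v ∈ U})).Reachable t o from hη).mono
    (openGraph_le (sdiff_le_sdiff_left hsub))

end QuantBHK

end Summit.CriticalPhenomena.PercolationContinuityZ3.Theorems
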